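import Mathlib
import Literature.NumberTheory.LFunctions.Zhang2022.Section17TruncMainNuMinus
import Literature.NumberTheory.LFunctions.Zhang2022.Section17NuMinusRadical
import Literature.NumberTheory.LFunctions.Zhang2022.ToolkitDivisorMajorants
import HarnessLib

/-!
# Zhang (2022) §17.u021, remainder `R₁`, piece M2L-p BULK (prime `m₂ = p` below the cutoff):
# the POINTWISE bound for `ν₁*(q₂p)`, `D⁴ < q₂p`, `4q₂p ≤ T²`

Topic `Literature/NumberTheory/LFunctions/Zhang2022` (Landau–Siegel audit tree; verdict-neutral).
Y. Zhang, *Discrete mean estimates and the Landau–Siegel zero*, arXiv:2211.02515v1 (2022)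
[Zhang2022LandauSiegel] — **an unrefereed manuscript under adjudication**; nothing here asserts or denies
its Theorems 1–2. §17 p. 98 (u021: "we can drop the terms with `m₂ > 1` … with an acceptable error" —
no bound in print). Lane ZHANG-L, WP16 leaf h17_9, sub-leaf `R₁` of `Typed.Section17.Step17_u021Chi`
(owner zl-libB-p6; CUT 2026-08-27T02:29:31Z, piece **M2L-p BULK** = prime `m₂ = p` with `D⁴ < q₂p` and
`4D⁴p ≤ T²`, this seat; the window `4D⁴p > T²` is zl-closer-1's). This file is the POINTWISE step: for
`1 ≤ q₂ < D⁴`, `p` prime with `D⁴ < q₂p` and `4q₂p ≤ T²`,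

  `‖ν₁*(q₂p)‖ ≤ 2‖ν⁻(q₂)‖ + Σ_{a′∣q₂, D⁴ < pa′} |ν(pa′)|²τ₂(q₂/a′) + 2δ·4τ₄(q₂)`

(`ν⁻(q₂) = Σ_{d∣q₂} μ(d)χ(d)`, `δ = 10α𝓛^{11/10} + ½e^{−𝓛³⁰}`): the three terms are the `ν⁻`-part
(radical, `Section17NuMinusRadical`), the `D⁴`-truncation tail — every divisor `a > D⁴` of `q₂p` is `p·a′`
with `a′ ∣ q₂`, so the tail lives on `n = pa′ ∈ (D⁴, T²D⁴]` where Lemma 3.1/3.2♭ (long range) act after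
summation — and the cutoff perturbation with the crude `Σ_{ab = q₂p}|ν(a)|τ₂(b) ≤ τ₄(q₂p) ≤ 4τ₄(q₂)`.
Inputs: `Section17TruncMainNuMinus.norm_nuOneStar_sub_nuMinus_le_linear` (p488745),
`Section17NuMinusRadical.norm_nuMinus_mul_le`, `ToolkitDivisorMajorants.tau_mul_le`.

Theorems only (no definitions, no named facts); axioms standard. WHAT THIS IS NOT: the summed bound
(M2L-p bulk `≤ ε`), which is the next file; any claim about Theorems 1–2 of the source.

## References

* Y. Zhang, arXiv:2211.02515v1 (2022), §17 p. 98 (u021). [cite: Zhang2022LandauSiegel, §17 u021 p.98]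
-/

noncomputable section

open Complex Real Finset ArithmeticFunction
open Literature.NumberTheory.LFunctions.Zhang2022.Skeleton
open Literature.NumberTheory.LFunctions.Zhang2022.Typed.Section17
open Literature.NumberTheory.LFunctions.Zhang2022.MeanSquareMajorant

namespace Literature.NumberTheory.LFunctions.Zhang2022.Phi3Eval

variable (c' : ℝ) {D : ℕ} (χ : DirichletCharacter ℂ D)

/-! ## §1. The perturbation weight: `Σ_{ab=v, a≤D⁴} |ν(a)|τ₂(b) ≤ τ₄(v)` and `τ₄(q₂p) ≤ 4τ₄(q₂)` -/

/-- `Σ_{ab = v, a ≤ D⁴} |ν(a)|τ₂(b) ≤ τ₄(v)` (`|ν| ≤ τ₂`, drop the filter, `τ₂ ∗ τ₂ = τ₄`).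
[cite: Zhang2022LandauSiegel, §17 u021 p.98] -/
theorem sum_filter_norm_nu_mul_tau_le_tau_four (v : ℕ) :
    ∑ q ∈ v.divisorsAntidiagonal with q.1 ≤ D ^ 4, ‖nu χ q.1‖ * tau 2 q.2 ≤ tau 4 v := by
  classical
  rw [show (4 : ℕ) = 2 + 2 from rfl, tau_add_apply]
  calc ∑ q ∈ v.divisorsAntidiagonal with q.1 ≤ D ^ 4, ‖nu χ q.1‖ * tau 2 q.2
      ≤ ∑ q ∈ v.divisorsAntidiagonal, ‖nu χ q.1‖ * tau 2 q.2 :=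
        Finset.sum_le_sum_of_subset_of_nonneg (Finset.filter_subset _ _) fun q _ _ =>
          mul_nonneg (norm_nonneg _) (tau_nonneg _ _)
    _ ≤ ∑ q ∈ v.divisorsAntidiagonal, tau 2 q.1 * tau 2 q.2 :=
        Finset.sum_le_sum fun q _ => mul_le_mul_of_nonneg_right
          (by rw [nu, tau_two_apply]; exact norm_divisorSumChar_le χ q.1) (tau_nonneg _ _)

/-- `τ₄(q₂p) ≤ 4τ₄(q₂)` for a prime `p` (`τ₄` sub-multiplicative, `τ₄(p) = 4`).
[cite: Zhang2022LandauSiegel, §17 u021 p.98] -/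
theorem tau_four_mul_prime_le (q₂ : ℕ) {p : ℕ} (hp : p.Prime) : tau 4 (q₂ * p) ≤ 4 * tau 4 q₂ := by
  have h := tau_mul_le 4 q₂ p
  rw [tau_prime 4 hp] at h
  push_cast at h
  linarith

/-! ## §2. The truncation tail at `v = q₂p`: every divisor `a > D⁴` is `p·a′`, `a′ ∣ q₂` -/

/-- **Re-indexing the tail**: for `p` prime and `q₂ < D⁴` (so `q₂ ≤ D⁴`),
`Σ_{ab = q₂p, a > D⁴} |ν(a)|²τ₂(b) ≤ Σ_{a′ ∣ q₂, D⁴ < pa′} |ν(pa′)|²τ₂(q₂/a′)`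
(a divisor `a > D⁴ ≥ q₂` of `q₂p` cannot divide `q₂`, so `p ∣ a`). [cite: Zhang2022LandauSiegel, §17 u021 p.98] -/
theorem tail_prime_arg_le {q₂ p : ℕ} (hq₂ : q₂ ≠ 0) (hq₂D : q₂ ≤ D ^ 4) (hp : p.Prime) :
    ∑ q ∈ (q₂ * p).divisorsAntidiagonal with D ^ 4 < q.1, ‖nu χ q.1‖ ^ 2 * tau 2 q.2 ≤
      ∑ a' ∈ q₂.divisors with D ^ 4 < p * a', ‖nu χ (p * a')‖ ^ 2 * tau 2 (q₂ / a') := by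
  classical
  have hp0 : p ≠ 0 := hp.ne_zero
  -- the map `a' ↦ (p a', q₂ / a')` from the right index set onto the left one
  have himage : ((q₂ * p).divisorsAntidiagonal.filter (fun q => D ^ 4 < q.1)) ⊆
      (q₂.divisors.filter (fun a' => D ^ 4 < p * a')).image (fun a' => (p * a', q₂ / a')) := by
    intro q hq
    rw [Finset.mem_filter, Nat.mem_divisorsAntidiagonal] at hq
    obtain ⟨⟨hprod, _⟩, hbig⟩ := hq
    -- `p ∣ q.1`: otherwise `q.1 ∣ q₂`, contradicting `q.1 > D⁴ ≥ q₂`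
    have hdvd : q.1 ∣ q₂ * p := ⟨q.2, hprod.symm⟩
    have hpq : p ∣ q.1 := by
      by_contra hnd
      have hcop : Nat.Coprime q.1 p := (Nat.coprime_comm.1 ((Nat.Prime.coprime_iff_not_dvd hp).2 hnd))
      have h1 : q.1 ∣ q₂ := hcop.dvd_of_dvd_mul_right hdvd
      have := Nat.le_of_dvd (Nat.pos_of_ne_zero hq₂) h1
      omega
    obtain ⟨a', ha'⟩ := hpq
    have ha'dvd : a' ∣ q₂ := by
      have : p * a' * q.2 = p * q₂ := by rw [← ha', hprod, mul_comm]
      exact ⟨q.2, by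
        have := this
        rw [mul_assoc] at this
        exact (Nat.eq_of_mul_eq_mul_left hp.pos this).symm⟩
    have ha'0 : a' ≠ 0 := fun h => by rw [h, mul_zero] at ha'; rw [ha', zero_mul] at hprod; exact (mul_ne_zero hq₂ hp0) hprod.symm
    refine Finset.mem_image.2 ⟨a', Finset.mem_filter.2 ⟨Nat.mem_divisors.2 ⟨ha'dvd, hq₂⟩, by rw [← ha']; exact hbig⟩, ?_⟩
    -- `(p a', q₂ / a') = q`
    have h2 : q.2 = q₂ / a' := by
      obtain ⟨r, hr⟩ := ha'dvd
      have h1 : q.1 * q.2 = q.1 * r := by rw [hprod, hr, ha']; ring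
      have hq1pos : 0 < q.1 := by rw [ha']; exact Nat.pos_of_ne_zero (mul_ne_zero hp0 ha'0)
      have hq2 : q.2 = r := Nat.eq_of_mul_eq_mul_left hq1pos h1
      rw [hq2, hr, Nat.mul_div_cancel_left r (Nat.pos_of_ne_zero ha'0)]
    exact Prod.ext ha'.symm h2.symm
  calc ∑ q ∈ (q₂ * p).divisorsAntidiagonal with D ^ 4 < q.1, ‖nu χ q.1‖ ^ 2 * tau 2 q.2
      ≤ ∑ q ∈ (q₂.divisors.filter (fun a' => D ^ 4 < p * a')).image (fun a' => (p * a', q₂ / a')),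
          ‖nu χ q.1‖ ^ 2 * tau 2 q.2 :=
        Finset.sum_le_sum_of_subset_of_nonneg himage fun q _ _ =>
          mul_nonneg (by positivity) (tau_nonneg _ _)
    _ ≤ ∑ a' ∈ q₂.divisors with D ^ 4 < p * a', ‖nu χ (p * a')‖ ^ 2 * tau 2 (q₂ / a') :=
        Finset.sum_image_le_of_nonneg fun u _ => mul_nonneg (by positivity) (tau_nonneg _ _)

/-! ## §3. The pointwise bound -/

/-- **M2L-p BULK, pointwise**: for a real `χ`, `𝓛 ≥ 3`, `|c′α𝓛| ≤ 1/14`, `1 ≤ q₂ ≤ D⁴`, `p` prime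
with `4q₂p ≤ T²`:
`‖ν₁*(q₂p)‖ ≤ 2‖ν⁻(q₂)‖ + Σ_{a′∣q₂, D⁴<pa′} |ν(pa′)|²τ₂(q₂/a′) + 2δ·4τ₄(q₂)`,
`δ = 10α𝓛^{11/10} + ½e^{−𝓛³⁰}`. [cite: Zhang2022LandauSiegel, §17 u021 p.98] -/
theorem norm_nuOneStar_prime_arg_le (hq : χ.IsQuadratic) (hℓ : 3 ≤ ell D)
    (hc : |c' * alpha D * ell D| ≤ 1 / 14) {q₂ p : ℕ} (hq₂ : q₂ ≠ 0) (hq₂D : q₂ ≤ D ^ 4)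
    (hp : p.Prime) (hvT : 4 * ((q₂ * p : ℕ) : ℝ) ≤ bigT D ^ 2) :
    ‖nuOneStar c' χ (q₂ * p)‖ ≤
      2 * ‖∑ d ∈ q₂.divisors, (ArithmeticFunction.moebius d : ℂ) * χ (d : ZMod D)‖ +
        (∑ a' ∈ q₂.divisors with D ^ 4 < p * a', ‖nu χ (p * a')‖ ^ 2 * tau 2 (q₂ / a')) +
        2 * (10 * alpha D * ell D ^ (11 / 10 : ℝ) + (1 / 2 : ℝ) * Real.exp (-(ell D ^ 30))) *
          (4 * tau 4 q₂) := by
  set δ : ℝ := 10 * alpha D * ell D ^ (11 / 10 : ℝ) + (1 / 2 : ℝ) * Real.exp (-(ell D ^ 30)) with hδ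
  have hmain := norm_nuOneStar_sub_nuMinus_le_linear c' χ hq hℓ hc hvT
  rw [← hδ] at hmain
  have hδ0 : 0 ≤ δ := by
    have hℓ0 : 0 < ell D := by linarith
    have := (alpha_pos' hℓ0).le
    positivity
  -- the three pieces
  have hrad : ‖∑ d ∈ (q₂ * p).divisors, (ArithmeticFunction.moebius d : ℂ) * χ (d : ZMod D)‖ ≤
      2 * ‖∑ d ∈ q₂.divisors, (ArithmeticFunction.moebius d : ℂ) * χ (d : ZMod D)‖ := by
    have h := norm_nuMinus_mul_le χ hq₂ hp.ne_zero
    rw [Nat.Prime.primeFactors hp, Finset.card_singleton, pow_one] at h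
    linarith
  have htail := tail_prime_arg_le χ hq₂ hq₂D hp
  have hpert : ∑ q ∈ (q₂ * p).divisorsAntidiagonal with q.1 ≤ D ^ 4, ‖nu χ q.1‖ * tau 2 q.2 ≤
      4 * tau 4 q₂ :=
    (sum_filter_norm_nu_mul_tau_le_tau_four χ (q₂ * p)).trans (tau_four_mul_prime_le q₂ hp)
  calc ‖nuOneStar c' χ (q₂ * p)‖
      ≤ ‖nuOneStar c' χ (q₂ * p) - ∑ d ∈ (q₂ * p).divisors, (ArithmeticFunction.moebius d : ℂ) *
          χ (d : ZMod D)‖ + ‖∑ d ∈ (q₂ * p).divisors, (ArithmeticFunction.moebius d : ℂ) * χ (d : ZMod D)‖ :=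
        norm_le_norm_sub_add _ _
    _ ≤ ((∑ q ∈ (q₂ * p).divisorsAntidiagonal with D ^ 4 < q.1, ‖nu χ q.1‖ ^ 2 * tau 2 q.2) +
          2 * δ * ∑ q ∈ (q₂ * p).divisorsAntidiagonal with q.1 ≤ D ^ 4, ‖nu χ q.1‖ * tau 2 q.2) +
          2 * ‖∑ d ∈ q₂.divisors, (ArithmeticFunction.moebius d : ℂ) * χ (d : ZMod D)‖ :=
        add_le_add hmain hrad
    _ ≤ ((∑ a' ∈ q₂.divisors with D ^ 4 < p * a', ‖nu χ (p * a')‖ ^ 2 * tau 2 (q₂ / a')) +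
          2 * δ * (4 * tau 4 q₂)) +
          2 * ‖∑ d ∈ q₂.divisors, (ArithmeticFunction.moebius d : ℂ) * χ (d : ZMod D)‖ := by
        gcongr
    _ = _ := by ring

end Literature.NumberTheory.LFunctions.Zhang2022.Phi3Eval
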